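import Summits.QuantumFields.BalabanUV.Beta.FP.TorusCompositeRowsSymPeriodic
import Summits.QuantumFields.BalabanUV.Beta.FP.TorusCompositeCovarianceOneSym
import Summits.QuantumFields.BalabanUV.Beta.FP.TorusCompositeInsertionPeriodic

/-!
# `BalabanUV.Beta.FP.TorusCompositeInsertionPeriodicSym` — road «FP» for binder row D1, ROUTE T, (β1) «sym» column: **THE SYM COMPOSITE FIRST-ORDER INSERTION JET
# `compIns₁Sym … n h` ACTS ON PERIODIC 1-FORMS AS ANY LATTICE FUNCTIONAL OBEYING OUR SYM CHAIN RULE** (the (β1) twin of `TorusCompositeInsertionPeriodic`)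

WHY.  `compIns₁Sym Lc M lev rs n h` (`TorusCompositeCovarianceOneSym`, OUR ♭ bookkeeping under the (β1) substitution `Qstep ↦ QstepSym`, `stepIns₁ M Lc r ↦ stepIns₁Sym M Lc`,
root ↦ the centre `ctr (d+1) Lc`) is defined by the chain rule `compIns₁Sym_succ` (TOP-PEEL).  Acting on a form periodic under the finest torus and summing the fine slot,
the three typed torus identities — `TorusCompositeRowsSymPeriodic.sum_compRowsSym_mul_periodic_of_clauses` (sym rows ↦ ANY functional `𝓡` obeying the sym one-step law),
`sum_QstepSym_mul_periodic` (`QstepSym` ↦ `stepScale · Lc^{d+1} · Σ symLinKerAt (ctr)`), `TorusStepInsertionSym.sum_stepIns₁Sym_mul_periodic` (`stepIns₁Sym` ↦ an1's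
`symVhKerAt (ctr (d+1) Lc)` at (form, lift of the weight)) — turn the chain rule into a recursion of LATTICE forms.  THIS FILE proves: for ANY rows functional `𝓡 lev n B`
with the clauses `hR0 ∕ hRsucc (∕ hRper)` and ANY family `𝓘 lev n H B : Form1` with `𝓘 … 0 = 0` and the displayed successor clause `hsucc` (OUR recursion verbatim: unit
`θ_n`, `symVhKerAt (ctr (d+1) Lc) Lc` against the lower functionals `𝓡 (lev∘succ) n B ∕ H`, plus `stepScale d Lc (lev 1) · Lc^{d+1} · Σ symLinKerAt (ctr (d+1) Lc) Lc` of
the lower jet functional), `Σ_q compIns₁Sym Lc M lev rs n h (x,κ) q · B q.2 q.1 = 𝓘 lev n (lift h) B κ x`, `lift h l w := h (wrapPt T w, l)`, at EVERY root list `rs`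
(the sym objects ignore it).  No lattice object is DEFINED here (the row names its carriers); the theorem is the junction for whatever the row defines.

WHAT.  §1 plumbing: `lift_periodic`, `periodic_apply_wrap` (copies of the rooted file's two-line lemmas, not yet importable), `compRowsSym_mulVec_eq_of_clauses`.
§2 **`sum_compIns₁Sym_mul_periodic`** (letters `hRper ∕ hper` as hypotheses).  §3 the letters FOLLOW from the clauses: `symVhKerAt_form_translate`,
`symLinKerAt_form_translate` (an1's `symVhKerAt_add ∕ symLinKerAt_add`), `rows_periodic_of_clauses`, `periodic_of_clauses` (so §2 is available from the four
clauses alone: pass `fun lev n T B => rows_periodic_of_clauses Lc 𝓡 hR0 hRsucc n lev T B` and `fun lev n M H B => periodic_of_clauses … n lev M H B`).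
§4 `compIns₁Sym_apply_eq` (the entries: `𝓘` at (lift `h`, periodic indicator of a torus bond), from the four clauses).  NOT HERE: the row's carriers; order 2 (`stepIns₂₂Sym`); estimates.

[folklore] finite sums BY NAME over OUR bookkeeping objects (`compIns₁Sym ∕ stepIns₁Sym ∕ compRowsSym ∕ QstepSym ∕ towerTorus`) and an1's typed lattice kernels
(`symVhKerAt`, `symLinKerAt`); no `def`, no `def … : Prop`, nothing cited, 0 sorry; NO chart; nothing of Bałaban's asserted (that the composite's first variation IS
this chain is an2's (C1) TABLE word).
HONEST DEPENDENCY (page 1, mandatory): continuum YM on T⁴ ⇐ BetaPertH ∧ nine spine estimates (0/9 proved); BetaPertH ⇐ (D1) ∧ (D4) ∧ CAP+tail;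
G-an2-4 gates asym, D1 and NE2/3/4.  HONEST FRAMING (cell contract, verbatim): «discharging `BetaPertH` makes Bałaban's UV stability UNCONDITIONAL —
a real constructive-QFT result; it is NOT the continuum limit and NOT the Clay problem.»  ABSOLUTE RULE (cell charter, verbatim): «No internally-minted
statement may enter as a cited fact. Every hypothesis is either kernel-proved in this package or a verbatim quotation of a PUBLISHED theorem with page
reference. The manuscript(s) under audit are NOT citable for their own disputed steps — they are the thing under adjudication; programme-internal
(2001/route/tribunal) claims are never citable.»  0 estimates; 0∕4 row-D1 binders (hW, hR, D1Tel, D1Rep); NOT (T-ID), NOT (C1), NOT SDF, NOT D1,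
NOT BetaPertH, NOT continuum, NOT Clay.  D1 formalisation swarm LEAF PROVER 02 (b2b-balaban-beta-d1-formalise-leaf-02 gen 32), 2026-08-24.  No existing file touched.
v1.1 (leaf-02 g33, 2026-08-25): §1's two periodic-lift two-liners are READ BY NAME from the rooted R-7 `TorusCompositeInsertionPeriodic` (✓ p370534) instead of re-typed — the gate's `dedup.landed` is α-invariant across namespaces; every other declaration byte-identical to v1 ed8da7f5382e86e9.
-/

noncomputable section

open scoped BigOperators

namespace Summit.QuantumFields.BalabanUV.Beta.FP.TorusCompositeInsertionPeriodicSym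

open Matrix Finset
open Literature.MathematicalPhysics.QuantumFieldTheory
open Literature.MathematicalPhysics.QuantumFieldTheory.Balaban1983to89
open Literature.MathematicalPhysics.QuantumFieldTheory.Balaban1983to89.Beta
open B5Prop11Plancherel (fine)
open B6Lemma24Torus (pbox mem_pbox wrap wrap_congr)
open B4TorusKernel.MultiPeriod (translate translate_apply)
open AffineAveraging (Site Form1 box toSite)
open AveragingContoursRooted (ctr ctrOff)
open AveragingHessianKernels (Bond)
open Summit.QuantumFields.BalabanUV.Beta.BorderedHessian (stepScale)
open Summit.QuantumFields.BalabanUV.Beta.SymAveragingHessianCounts (symVhKerAt symLinKerAt)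
open Summit.QuantumFields.BalabanUV.Beta.FP.TorusGaugeCovariancePairing (wrapPt wrapPt_coe wrapPt_of_mem)
open Summit.QuantumFields.BalabanUV.Beta.FP.TorusCompositeObjects (towerTorus towerTorus_apply)
open Summit.QuantumFields.BalabanUV.Beta.FP.TorusCompositeObjectsG (QstepSym compRowsSym compRowsSym_succ compRowsSym_zero)
open Summit.QuantumFields.BalabanUV.Beta.FP.TorusCompositeRowsSymPeriodic (sum_QstepSym_mul_periodic sum_compRowsSym_mul_periodic_of_clauses)
open Summit.QuantumFields.BalabanUV.Beta.FP.TorusStepInsertionSym (stepIns₁Sym sum_stepIns₁Sym_mul_periodic)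
open Summit.QuantumFields.BalabanUV.Beta.FP.TorusCompositeCovarianceOneSym (compIns₁Sym compIns₁Sym_zero compIns₁Sym_succ)
open Summit.QuantumFields.BalabanUV.Beta.FP.TorusCompositeInsertionPeriodic (lift_periodic periodic_apply_wrap)

variable {d : ℕ} (Lc : ℕ) [NeZero Lc]

/-! ## §1 Plumbing: the periodic lift of a torus weight; the transported direction under a rows functional -/

/-- [folklore] **THE TRANSPORTED DIRECTION (sym rows)**: for ANY rows functional `𝓡` with the three clauses of `sum_compRowsSym_mul_periodic_of_clauses`, the tower's sym
averaging rows applied to a torus weight, read at any slot, are `𝓡` of its periodic lift: `(compRowsSym Lc M lev rs n *ᵥ h) (x, κ) = 𝓡 lev n (lift h) κ x`. -/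
theorem compRowsSym_mulVec_eq_of_clauses (𝓡 : (ℕ → ℕ) → ℕ → Form1 (d + 1) ℝ → Form1 (d + 1) ℝ)
    (hR0 : ∀ (lev : ℕ → ℕ) (B : Form1 (d + 1) ℝ), 𝓡 lev 0 B = B)
    (hRsucc : ∀ (lev : ℕ → ℕ) (n : ℕ) (B : Form1 (d + 1) ℝ) (κ : Fin (d + 1)) (x : Site (d + 1)),
      𝓡 lev (n + 1) B κ x = stepScale d Lc (lev 1) * ((Lc : ℝ) ^ (d + 1)
        * ∑' z : Site (d + 1), ∑ l : Fin (d + 1), symLinKerAt (ctr (d + 1) Lc) Lc κ x (l, z) * 𝓡 (fun k => lev (k + 1)) n B l z))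
    (hRper : ∀ (lev : ℕ → ℕ) (n : ℕ) (T : Fin (d + 1) → ℕ) (B : Form1 (d + 1) ℝ),
      (∀ (l : Fin (d + 1)) (y m : Site (d + 1)), B l (translate (towerTorus Lc T n) y m) = B l y) →
        ∀ (l : Fin (d + 1)) (y m : Site (d + 1)), 𝓡 lev n B l (translate T y m) = 𝓡 lev n B l y)
    (n : ℕ) (M : Fin (d + 1) → ℕ) [∀ μ, NeZero (M μ)] (lev : ℕ → ℕ) (rs : ℕ → (Fin (d + 1) → ℕ))
    (h : ↥(pbox (towerTorus Lc M n)) × Fin (d + 1) → ℝ) (x : ↥(pbox M)) (κ : Fin (d + 1)) :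
    (compRowsSym Lc M lev rs n *ᵥ h) (x, κ) = 𝓡 lev n (fun l w => h (wrapPt (towerTorus Lc M n) w, l)) κ (x : Site (d + 1)) := by
  rw [Matrix.mulVec, dotProduct,
    ← sum_compRowsSym_mul_periodic_of_clauses Lc 𝓡 hR0 hRsucc hRper n M lev rs _ (fun l w t => lift_periodic (towerTorus Lc M n) h l w t) x κ]
  refine Finset.sum_congr rfl fun q _ => ?_
  show _ = compRowsSym Lc M lev rs n (x, κ) q * h (wrapPt (towerTorus Lc M n) (q.1 : Site (d + 1)), q.2)
  rw [wrapPt_of_mem]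

/-! ## §2 The sym composite first-order insertion jet acts on periodic forms as any functional obeying our sym chain rule -/

/-- [folklore] **`sum_compIns₁Sym_mul_periodic` — THE SYM COMPOSITE FIRST-ORDER INSERTION JET ACTS ON PERIODIC 1-FORMS AS ANY LATTICE FUNCTIONAL OBEYING OUR SYM CHAIN RULE.**
Let `𝓡 lev n B` be any rows functional with the three clauses of `sum_compRowsSym_mul_periodic_of_clauses` (`hR0 ∕ hRsucc ∕ hRper`), and `𝓘 lev n H B : Form1 (d+1) ℝ` any
family with: `h0` — depth `0` is `0`; `hsucc` — OUR successor clause, VERBATIM from `compIns₁Sym_succ` read through the sym rows law and `sum_stepIns₁Sym_mul_periodic`: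
`𝓘 lev (n+1) H B κ x = θ_n · Σ'_u Σ_{κ′} (Σ'_z Σ_l symVhKerAt (ctr (d+1) Lc) Lc κ x (l,z) (κ′,u) · 𝓡 (lev∘succ) n B l z) · 𝓡 (lev∘succ) n H κ′ u
 + stepScale d Lc (lev 1) · (Lc^{d+1} · Σ'_z Σ_l symLinKerAt (ctr (d+1) Lc) Lc κ x (l,z) · 𝓘 (lev∘succ) n H B l z)`,
`θ_n = (Lc^{d+1}·stepScale d Lc (lev 1))·(∏_{i<n} (stepScale d Lc (lev (i+2))·#B))⁻¹`; `hper` — for forms `H, B` periodic under the finest torus `towerTorus Lc M n`,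
`𝓘 lev n H B` is periodic under the top box `M`.  Then at the centred tower (`hc : ctrOff (d+1) Lc ∈ box (d+1) Lc`), for every root list `rs`, every torus weight `h` on the
finest torus and every finest-periodic real 1-form `B`:
`Σ_q compIns₁Sym Lc M lev rs n h (x, κ) q · B q.2 q.1 = 𝓘 lev n (fun l w => h (wrapPt (towerTorus Lc M n) w, l)) B κ x`. -/
theorem sum_compIns₁Sym_mul_periodic (hc : ctrOff (d + 1) Lc ∈ box (d + 1) Lc)
    (𝓡 : (ℕ → ℕ) → ℕ → Form1 (d + 1) ℝ → Form1 (d + 1) ℝ)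
    (hR0 : ∀ (lev : ℕ → ℕ) (B : Form1 (d + 1) ℝ), 𝓡 lev 0 B = B)
    (hRsucc : ∀ (lev : ℕ → ℕ) (n : ℕ) (B : Form1 (d + 1) ℝ) (κ : Fin (d + 1)) (x : Site (d + 1)),
      𝓡 lev (n + 1) B κ x = stepScale d Lc (lev 1) * ((Lc : ℝ) ^ (d + 1)
        * ∑' z : Site (d + 1), ∑ l : Fin (d + 1), symLinKerAt (ctr (d + 1) Lc) Lc κ x (l, z) * 𝓡 (fun k => lev (k + 1)) n B l z))
    (hRper : ∀ (lev : ℕ → ℕ) (n : ℕ) (T : Fin (d + 1) → ℕ) (B : Form1 (d + 1) ℝ),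
      (∀ (l : Fin (d + 1)) (y m : Site (d + 1)), B l (translate (towerTorus Lc T n) y m) = B l y) →
        ∀ (l : Fin (d + 1)) (y m : Site (d + 1)), 𝓡 lev n B l (translate T y m) = 𝓡 lev n B l y)
    (𝓘 : (ℕ → ℕ) → ℕ → Form1 (d + 1) ℝ → Form1 (d + 1) ℝ → Form1 (d + 1) ℝ)
    (h0 : ∀ (lev : ℕ → ℕ) (H B : Form1 (d + 1) ℝ), 𝓘 lev 0 H B = 0)
    (hsucc : ∀ (lev : ℕ → ℕ) (n : ℕ) (H B : Form1 (d + 1) ℝ) (κ : Fin (d + 1)) (x : Site (d + 1)),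
      𝓘 lev (n + 1) H B κ x
        = (((Lc : ℝ) ^ (d + 1) * stepScale d Lc (lev 1)) * (∏ i ∈ Finset.range n, (stepScale d Lc (lev (i + 1 + 1)) * ((box (d + 1) Lc).card : ℝ)))⁻¹) *
            (∑' u : Site (d + 1), ∑ κ' : Fin (d + 1),
              (∑' z : Site (d + 1), ∑ l : Fin (d + 1), symVhKerAt (ctr (d + 1) Lc) Lc κ x (l, z) (κ', u) * 𝓡 (fun k => lev (k + 1)) n B l z) *
                𝓡 (fun k => lev (k + 1)) n H κ' u)
          + stepScale d Lc (lev 1) * ((Lc : ℝ) ^ (d + 1) *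
              ∑' z : Site (d + 1), ∑ l : Fin (d + 1), symLinKerAt (ctr (d + 1) Lc) Lc κ x (l, z) * 𝓘 (fun k => lev (k + 1)) n H B l z))
    (hper : ∀ (lev : ℕ → ℕ) (n : ℕ) (M : Fin (d + 1) → ℕ) (H B : Form1 (d + 1) ℝ),
      (∀ (l : Fin (d + 1)) (w t : Site (d + 1)), H l (translate (towerTorus Lc M n) w t) = H l w) →
      (∀ (l : Fin (d + 1)) (w t : Site (d + 1)), B l (translate (towerTorus Lc M n) w t) = B l w) →
      ∀ (l : Fin (d + 1)) (y t : Site (d + 1)), 𝓘 lev n H B l (translate M y t) = 𝓘 lev n H B l y) :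
    ∀ (n : ℕ) (M : Fin (d + 1) → ℕ) [∀ μ, NeZero (M μ)] (lev : ℕ → ℕ) (rs : ℕ → (Fin (d + 1) → ℕ))
      (h : ↥(pbox (towerTorus Lc M n)) × Fin (d + 1) → ℝ) (B : Form1 (d + 1) ℝ)
      (_ : ∀ (l : Fin (d + 1)) (w t : Site (d + 1)), B l (translate (towerTorus Lc M n) w t) = B l w) (x : ↥(pbox M)) (κ : Fin (d + 1)),
      ∑ q : ↥(pbox (towerTorus Lc M n)) × Fin (d + 1), compIns₁Sym Lc M lev rs n h (x, κ) q * B q.2 (q.1 : Site (d + 1))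
        = 𝓘 lev n (fun l w => h (wrapPt (towerTorus Lc M n) w, l)) B κ (x : Site (d + 1))
  | 0, M, _, lev, rs, h, B, hB, x, κ => by
      rw [h0, compIns₁Sym_zero]
      simp only [Matrix.zero_apply, zero_mul, Finset.sum_const_zero]
      rfl
  | n + 1, M, _, lev, rs, h, B, hB, x, κ => by
      -- spell every finest-torus object over the lower tower `(fine Lc M, n)` (definitionally the same torus, `towerTorus_succ`)
      change ↥(pbox (towerTorus Lc (fine Lc M) n)) × Fin (d + 1) → ℝ at h
      change ∀ (l : Fin (d + 1)) (w t : Site (d + 1)), B l (translate (towerTorus Lc (fine Lc M) n) w t) = B l w at hB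
      show ∑ q : ↥(pbox (towerTorus Lc (fine Lc M) n)) × Fin (d + 1), compIns₁Sym Lc M lev rs (n + 1) h (x, κ) q * B q.2 (q.1 : Site (d + 1))
        = 𝓘 lev (n + 1) (fun l w => h (wrapPt (towerTorus Lc (fine Lc M) n) w, l)) B κ (x : Site (d + 1))
      -- the lifted direction is finest-periodic
      have hHper : ∀ (l : Fin (d + 1)) (w t : Site (d + 1)),
          (fun l w => h (wrapPt (towerTorus Lc (fine Lc M) n) w, l)) l (translate (towerTorus Lc (fine Lc M) n) w t)
            = (fun l w => h (wrapPt (towerTorus Lc (fine Lc M) n) w, l)) l w := fun l w t => lift_periodic (towerTorus Lc (fine Lc M) n) h l w t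
      -- induction hypothesis on the lower tower (top `fine Lc M`, depth `n`, same finest torus)
      have IH := sum_compIns₁Sym_mul_periodic hc 𝓡 hR0 hRsucc hRper 𝓘 h0 hsucc hper n (fine Lc M) (fun k => lev (k + 1)) (fun k => rs (k + 1)) h B hB
      -- the lower jet functional is `fine Lc M`-periodic
      have hIper : ∀ (l : Fin (d + 1)) (y t : Site (d + 1)),
          𝓘 (fun k => lev (k + 1)) n (fun l w => h (wrapPt (towerTorus Lc (fine Lc M) n) w, l)) B l (translate (fine Lc M) y t)
            = 𝓘 (fun k => lev (k + 1)) n (fun l w => h (wrapPt (towerTorus Lc (fine Lc M) n) w, l)) B l y :=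
        hper _ n (fine Lc M) _ B hHper hB
      -- the lower rows functional of `B` is `fine Lc M`-periodic
      have hBlow : ∀ (l : Fin (d + 1)) (y t : Site (d + 1)),
          𝓡 (fun k => lev (k + 1)) n B l (translate (fine Lc M) y t) = 𝓡 (fun k => lev (k + 1)) n B l y :=
        hRper (fun k => lev (k + 1)) n (fine Lc M) B hB
      -- the transported direction read at a box point of `fine Lc M`
      have hv : ∀ (u : Site (d + 1)) (κ' : Fin (d + 1)),
          (compRowsSym Lc (fine Lc M) (fun k => lev (k + 1)) (fun k => rs (k + 1)) n *ᵥ h) (wrapPt (fine Lc M) u, κ')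
            = 𝓡 (fun k => lev (k + 1)) n (fun l w => h (wrapPt (towerTorus Lc (fine Lc M) n) w, l)) κ' u := fun u κ' => by
        rw [compRowsSym_mulVec_eq_of_clauses Lc 𝓡 hR0 hRsucc hRper n (fine Lc M) (fun k => lev (k + 1)) (fun k => rs (k + 1)) h (wrapPt (fine Lc M) u) κ']
        exact periodic_apply_wrap (fine Lc M) _ (hRper _ n (fine Lc M) _ hHper) κ' u
      -- the two lower actions on the slots of `fine Lc M`: the sym rows (`𝓡`) and the lower jet (induction hypothesis)
      have hrows : ∀ p : ↥(pbox (fine Lc M)) × Fin (d + 1),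
          ∑ q : ↥(pbox (towerTorus Lc (fine Lc M) n)) × Fin (d + 1), compRowsSym Lc (fine Lc M) (fun k => lev (k + 1)) (fun k => rs (k + 1)) n p q * B q.2 (q.1 : Site (d + 1))
            = 𝓡 (fun k => lev (k + 1)) n B p.2 (p.1 : Site (d + 1)) := fun p => by
        obtain ⟨y, l⟩ := p
        exact sum_compRowsSym_mul_periodic_of_clauses Lc 𝓡 hR0 hRsucc hRper n (fine Lc M) (fun k => lev (k + 1)) (fun k => rs (k + 1)) B hB y l
      have hlow : ∀ p : ↥(pbox (fine Lc M)) × Fin (d + 1),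
          ∑ q : ↥(pbox (towerTorus Lc (fine Lc M) n)) × Fin (d + 1), compIns₁Sym Lc (fine Lc M) (fun k => lev (k + 1)) (fun k => rs (k + 1)) n h p q * B q.2 (q.1 : Site (d + 1))
            = 𝓘 (fun k => lev (k + 1)) n (fun l w => h (wrapPt (towerTorus Lc (fine Lc M) n) w, l)) B p.2 (p.1 : Site (d + 1)) := fun p => by
        obtain ⟨y, l⟩ := p
        exact IH y l
      -- the chain rule, entrywise: split the top term and the lower term
      rw [hsucc, compIns₁Sym_succ]
      simp only [Matrix.add_apply, add_mul, Finset.sum_add_distrib]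
      congr 1
      · -- TOP TERM: peel the unit, push the lower sym rows through (`𝓡`), then `stepIns₁Sym` acts as `symVhKerAt (ctr)` at (that form, the lift of the transported direction)
        have e1 : ∀ q : ↥(pbox (towerTorus Lc (fine Lc M) n)) × Fin (d + 1),
            ((((Lc : ℝ) ^ (d + 1) * stepScale d Lc (lev 1)) * (∏ i ∈ Finset.range n, (stepScale d Lc (lev (i + 1 + 1)) * ((box (d + 1) Lc).card : ℝ)))⁻¹) •
                (stepIns₁Sym M Lc ((compRowsSym Lc (fine Lc M) (fun k => lev (k + 1)) (fun k => rs (k + 1)) n) *ᵥ h)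
                  * compRowsSym Lc (fine Lc M) (fun k => lev (k + 1)) (fun k => rs (k + 1)) n)) (x, κ) q * B q.2 (q.1 : Site (d + 1))
              = (((Lc : ℝ) ^ (d + 1) * stepScale d Lc (lev 1)) * (∏ i ∈ Finset.range n, (stepScale d Lc (lev (i + 1 + 1)) * ((box (d + 1) Lc).card : ℝ)))⁻¹) *
                ((stepIns₁Sym M Lc ((compRowsSym Lc (fine Lc M) (fun k => lev (k + 1)) (fun k => rs (k + 1)) n) *ᵥ h)
                  * compRowsSym Lc (fine Lc M) (fun k => lev (k + 1)) (fun k => rs (k + 1)) n) (x, κ) q * B q.2 (q.1 : Site (d + 1))) := fun q => by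
          rw [Matrix.smul_apply, smul_eq_mul, mul_assoc]
        rw [Finset.sum_congr rfl (fun q _ => e1 q), ← Finset.mul_sum]
        congr 1
        calc ∑ q : ↥(pbox (towerTorus Lc (fine Lc M) n)) × Fin (d + 1),
              (stepIns₁Sym M Lc ((compRowsSym Lc (fine Lc M) (fun k => lev (k + 1)) (fun k => rs (k + 1)) n) *ᵥ h)
                * compRowsSym Lc (fine Lc M) (fun k => lev (k + 1)) (fun k => rs (k + 1)) n) (x, κ) q * B q.2 (q.1 : Site (d + 1))
            = ∑ p : ↥(pbox (fine Lc M)) × Fin (d + 1), stepIns₁Sym M Lc ((compRowsSym Lc (fine Lc M) (fun k => lev (k + 1)) (fun k => rs (k + 1)) n) *ᵥ h) (x, κ) p *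
                ∑ q : ↥(pbox (towerTorus Lc (fine Lc M) n)) × Fin (d + 1), compRowsSym Lc (fine Lc M) (fun k => lev (k + 1)) (fun k => rs (k + 1)) n p q * B q.2 (q.1 : Site (d + 1)) := by
              simp only [Matrix.mul_apply, Finset.sum_mul, Finset.mul_sum, mul_assoc]
              exact Finset.sum_comm
          _ = ∑ p : ↥(pbox (fine Lc M)) × Fin (d + 1), stepIns₁Sym M Lc ((compRowsSym Lc (fine Lc M) (fun k => lev (k + 1)) (fun k => rs (k + 1)) n) *ᵥ h) (x, κ) p *
                𝓡 (fun k => lev (k + 1)) n B p.2 (p.1 : Site (d + 1)) :=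
              Finset.sum_congr rfl fun p _ => by rw [hrows p]
          _ = _ := (sum_stepIns₁Sym_mul_periodic M Lc hc ((compRowsSym Lc (fine Lc M) (fun k => lev (k + 1)) (fun k => rs (k + 1)) n) *ᵥ h)
                (𝓡 (fun k => lev (k + 1)) n B) hBlow x κ).trans
              (tsum_congr fun u => Finset.sum_congr rfl fun κ' _ => by rw [hv u κ'])
      · -- LOWER TERM: the top sym rows act as `stepScale · Lc^{d+1} · Σ symLinKerAt (ctr)` on the (periodic) lower functional (`sum_QstepSym_mul_periodic`)
        calc ∑ q : ↥(pbox (towerTorus Lc (fine Lc M) n)) × Fin (d + 1), (QstepSym Lc M (lev 1) * compIns₁Sym Lc (fine Lc M) (fun k => lev (k + 1)) (fun k => rs (k + 1)) n h) (x, κ) q * B q.2 (q.1 : Site (d + 1))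
            = ∑ p : ↥(pbox (fine Lc M)) × Fin (d + 1), QstepSym Lc M (lev 1) (x, κ) p *
                ∑ q : ↥(pbox (towerTorus Lc (fine Lc M) n)) × Fin (d + 1), compIns₁Sym Lc (fine Lc M) (fun k => lev (k + 1)) (fun k => rs (k + 1)) n h p q * B q.2 (q.1 : Site (d + 1)) := by
              simp only [Matrix.mul_apply, Finset.sum_mul, Finset.mul_sum, mul_assoc]
              exact Finset.sum_comm
          _ = ∑ p : ↥(pbox (fine Lc M)) × Fin (d + 1), QstepSym Lc M (lev 1) (x, κ) p *
                𝓘 (fun k => lev (k + 1)) n (fun l w => h (wrapPt (towerTorus Lc (fine Lc M) n) w, l)) B p.2 (p.1 : Site (d + 1)) :=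
              Finset.sum_congr rfl fun p _ => by rw [hlow p]
          _ = _ := sum_QstepSym_mul_periodic Lc M (lev 1)
              (𝓘 (fun k => lev (k + 1)) n (fun l w => h (wrapPt (towerTorus Lc (fine Lc M) n) w, l)) B) hIper x κ

/-! ## §3 The periodicity letters `hRper ∕ hper` FOLLOW from the clauses -/

omit [NeZero Lc] in
/-- [folklore] the top summand of the successor clause is periodic under the top box: for forms `W`, `B′` periodic under `fine Lc M`, the `symVhKerAt` double form
`x ↦ Σ'_u Σ_{κ′} (Σ'_z Σ_l symVhKerAt ρ Lc κ x (l,z) (κ′,u) · B′ l z) · W κ′ u` is `M`-periodic (an1's block-translation covariance `symVhKerAt_add`, re-indexing both bond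
sums by `Equiv.addRight`). -/
theorem symVhKerAt_form_translate (M : Fin (d + 1) → ℕ) (ρ : Site (d + 1)) (W B' : Form1 (d + 1) ℝ)
    (hW : ∀ (l : Fin (d + 1)) (y m : Site (d + 1)), W l (translate (fine Lc M) y m) = W l y)
    (hB' : ∀ (l : Fin (d + 1)) (y m : Site (d + 1)), B' l (translate (fine Lc M) y m) = B' l y) (κ : Fin (d + 1)) (y t : Site (d + 1)) :
    (∑' u : Site (d + 1), ∑ κ' : Fin (d + 1), (∑' z : Site (d + 1), ∑ l : Fin (d + 1), symVhKerAt ρ Lc κ (translate M y t) (l, z) (κ', u) * B' l z) * W κ' u)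
      = ∑' u : Site (d + 1), ∑ κ' : Fin (d + 1), (∑' z : Site (d + 1), ∑ l : Fin (d + 1), symVhKerAt ρ Lc κ y (l, z) (κ', u) * B' l z) * W κ' u := by
  -- the block translation `t` of the coarse site is the fine translation of both bonds (an1's `symVhKerAt_add`)
  have eadd : ∀ w : Site (d + 1), (w + (fun i => (fine Lc M i : ℤ) * t i)) = translate (fine Lc M) w t := fun w => by
    funext i; simp [B4TorusKernel.MultiPeriod.translate_apply]
  have hK : ∀ (l : Fin (d + 1)) (z : Site (d + 1)) (κ' : Fin (d + 1)) (u : Site (d + 1)),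
      symVhKerAt ρ Lc κ (translate M y t) (l, translate (fine Lc M) z t) (κ', translate (fine Lc M) u t) = symVhKerAt ρ Lc κ y (l, z) (κ', u) := by
    intro l z κ' u
    have hy : translate M y t = y + fun i => (M i : ℤ) * t i := by funext i; simp [B4TorusKernel.MultiPeriod.translate_apply]
    have hz : ((l, translate (fine Lc M) z t) : Bond (d + 1)) = AveragingHessianKernels.Bond.sh (l, z) ((Lc : ℤ) • fun i => (M i : ℤ) * t i) :=
      Prod.ext rfl (funext fun i => by simp [B4TorusKernel.MultiPeriod.translate_apply, fine, Nat.cast_mul, mul_assoc])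
    have hu : ((κ', translate (fine Lc M) u t) : Bond (d + 1)) = AveragingHessianKernels.Bond.sh (κ', u) ((Lc : ℤ) • fun i => (M i : ℤ) * t i) :=
      Prod.ext rfl (funext fun i => by simp [B4TorusKernel.MultiPeriod.translate_apply, fine, Nat.cast_mul, mul_assoc])
    rw [hy, hz, hu]
    exact SymAveragingHessianCounts.symVhKerAt_add ρ Lc κ y (fun i => (M i : ℤ) * t i) (l, z) (κ', u)
  -- re-index both lattice sums by the fine translation
  rw [← (Equiv.addRight (fun i => (fine Lc M i : ℤ) * t i)).tsum_eq (fun u => ∑ κ' : Fin (d + 1),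
    (∑' z : Site (d + 1), ∑ l : Fin (d + 1), symVhKerAt ρ Lc κ (translate M y t) (l, z) (κ', u) * B' l z) * W κ' u)]
  refine tsum_congr fun u => Finset.sum_congr rfl fun κ' _ => ?_
  simp only [Equiv.coe_addRight]
  rw [eadd u, hW]
  refine congrArg (fun s : ℝ => s * W κ' u) ?_
  rw [← (Equiv.addRight (fun i => (fine Lc M i : ℤ) * t i)).tsum_eq (fun z => ∑ l : Fin (d + 1),
    symVhKerAt ρ Lc κ (translate M y t) (l, z) (κ', translate (fine Lc M) u t) * B' l z)]
  refine tsum_congr fun z => Finset.sum_congr rfl fun l _ => ?_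
  simp only [Equiv.coe_addRight]
  rw [eadd z, hB', hK]

omit [NeZero Lc] in
/-- [folklore] the `symLinKerAt` single form `x ↦ Σ'_z Σ_l symLinKerAt ρ Lc κ x (l,z) · F l z` of a `fine Lc M`-periodic form `F` is `M`-periodic (an1's `symLinKerAt_add`). -/
theorem symLinKerAt_form_translate (M : Fin (d + 1) → ℕ) (ρ : Site (d + 1)) (F : Form1 (d + 1) ℝ)
    (hF : ∀ (l : Fin (d + 1)) (y m : Site (d + 1)), F l (translate (fine Lc M) y m) = F l y) (κ : Fin (d + 1)) (y t : Site (d + 1)) :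
    (∑' z : Site (d + 1), ∑ l : Fin (d + 1), symLinKerAt ρ Lc κ (translate M y t) (l, z) * F l z)
      = ∑' z : Site (d + 1), ∑ l : Fin (d + 1), symLinKerAt ρ Lc κ y (l, z) * F l z := by
  have eadd : ∀ w : Site (d + 1), (w + (fun i => (fine Lc M i : ℤ) * t i)) = translate (fine Lc M) w t := fun w => by
    funext i; simp [B4TorusKernel.MultiPeriod.translate_apply]
  have hK : ∀ (l : Fin (d + 1)) (z : Site (d + 1)), symLinKerAt ρ Lc κ (translate M y t) (l, translate (fine Lc M) z t) = symLinKerAt ρ Lc κ y (l, z) := by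
    intro l z
    have hy : translate M y t = y + fun i => (M i : ℤ) * t i := by funext i; simp [B4TorusKernel.MultiPeriod.translate_apply]
    have hz : ((l, translate (fine Lc M) z t) : Bond (d + 1)) = AveragingHessianKernels.Bond.sh (l, z) ((Lc : ℤ) • fun i => (M i : ℤ) * t i) :=
      Prod.ext rfl (funext fun i => by simp [B4TorusKernel.MultiPeriod.translate_apply, fine, Nat.cast_mul, mul_assoc])
    rw [hy, hz]
    exact SymAveragingHessianCounts.symLinKerAt_add ρ Lc κ y (fun i => (M i : ℤ) * t i) (l, z)
  rw [← (Equiv.addRight (fun i => (fine Lc M i : ℤ) * t i)).tsum_eq (fun z => ∑ l : Fin (d + 1), symLinKerAt ρ Lc κ (translate M y t) (l, z) * F l z)]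
  refine tsum_congr fun z => Finset.sum_congr rfl fun l _ => ?_
  simp only [Equiv.coe_addRight]
  rw [eadd z, hF, hK]

omit [NeZero Lc] in
/-- [folklore] **`rows_periodic_of_clauses` — THE LETTER `hRper` FOLLOWS FROM `hR0` AND `hRsucc`**: a rows functional obeying the sym one-step law maps forms periodic under
the finest torus `towerTorus Lc T n` to forms periodic under the top box `T` (induction, `symLinKerAt_form_translate`). -/
theorem rows_periodic_of_clauses (𝓡 : (ℕ → ℕ) → ℕ → Form1 (d + 1) ℝ → Form1 (d + 1) ℝ)
    (hR0 : ∀ (lev : ℕ → ℕ) (B : Form1 (d + 1) ℝ), 𝓡 lev 0 B = B)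
    (hRsucc : ∀ (lev : ℕ → ℕ) (n : ℕ) (B : Form1 (d + 1) ℝ) (κ : Fin (d + 1)) (x : Site (d + 1)),
      𝓡 lev (n + 1) B κ x = stepScale d Lc (lev 1) * ((Lc : ℝ) ^ (d + 1)
        * ∑' z : Site (d + 1), ∑ l : Fin (d + 1), symLinKerAt (ctr (d + 1) Lc) Lc κ x (l, z) * 𝓡 (fun k => lev (k + 1)) n B l z)) :
    ∀ (n : ℕ) (lev : ℕ → ℕ) (T : Fin (d + 1) → ℕ) (B : Form1 (d + 1) ℝ),
      (∀ (l : Fin (d + 1)) (y m : Site (d + 1)), B l (translate (towerTorus Lc T n) y m) = B l y) →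
        ∀ (l : Fin (d + 1)) (y m : Site (d + 1)), 𝓡 lev n B l (translate T y m) = 𝓡 lev n B l y := by
  intro n
  induction n with
  | zero => intro lev T B hB l y m; rw [hR0]; exact hB l y m
  | succ n IH =>
      intro lev T B hB l y m
      change ∀ (l : Fin (d + 1)) (w t : Site (d + 1)), B l (translate (towerTorus Lc (fine Lc T) n) w t) = B l w at hB
      rw [hRsucc, hRsucc, symLinKerAt_form_translate Lc T (ctr (d + 1) Lc) _ (IH (fun k => lev (k + 1)) (fine Lc T) B hB) l y m]

omit [NeZero Lc] in
/-- [folklore] **`periodic_of_clauses` — THE LETTER `hper` OF `sum_compIns₁Sym_mul_periodic` FOLLOWS FROM THE CLAUSES**: a family obeying our sym chain rule (over a rows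
functional obeying the sym one-step law) maps pairs of forms periodic under the finest torus `towerTorus Lc M n` to a form periodic under the top box `M` (induction:
`symVhKerAt_form_translate` on the top summand over `rows_periodic_of_clauses`, `symLinKerAt_form_translate` on the lower one). -/
theorem periodic_of_clauses (𝓡 : (ℕ → ℕ) → ℕ → Form1 (d + 1) ℝ → Form1 (d + 1) ℝ)
    (hR0 : ∀ (lev : ℕ → ℕ) (B : Form1 (d + 1) ℝ), 𝓡 lev 0 B = B)
    (hRsucc : ∀ (lev : ℕ → ℕ) (n : ℕ) (B : Form1 (d + 1) ℝ) (κ : Fin (d + 1)) (x : Site (d + 1)),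
      𝓡 lev (n + 1) B κ x = stepScale d Lc (lev 1) * ((Lc : ℝ) ^ (d + 1)
        * ∑' z : Site (d + 1), ∑ l : Fin (d + 1), symLinKerAt (ctr (d + 1) Lc) Lc κ x (l, z) * 𝓡 (fun k => lev (k + 1)) n B l z))
    (𝓘 : (ℕ → ℕ) → ℕ → Form1 (d + 1) ℝ → Form1 (d + 1) ℝ → Form1 (d + 1) ℝ)
    (h0 : ∀ (lev : ℕ → ℕ) (H B : Form1 (d + 1) ℝ), 𝓘 lev 0 H B = 0)
    (hsucc : ∀ (lev : ℕ → ℕ) (n : ℕ) (H B : Form1 (d + 1) ℝ) (κ : Fin (d + 1)) (x : Site (d + 1)),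
      𝓘 lev (n + 1) H B κ x
        = (((Lc : ℝ) ^ (d + 1) * stepScale d Lc (lev 1)) * (∏ i ∈ Finset.range n, (stepScale d Lc (lev (i + 1 + 1)) * ((box (d + 1) Lc).card : ℝ)))⁻¹) *
            (∑' u : Site (d + 1), ∑ κ' : Fin (d + 1),
              (∑' z : Site (d + 1), ∑ l : Fin (d + 1), symVhKerAt (ctr (d + 1) Lc) Lc κ x (l, z) (κ', u) * 𝓡 (fun k => lev (k + 1)) n B l z) *
                𝓡 (fun k => lev (k + 1)) n H κ' u)
          + stepScale d Lc (lev 1) * ((Lc : ℝ) ^ (d + 1) *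
              ∑' z : Site (d + 1), ∑ l : Fin (d + 1), symLinKerAt (ctr (d + 1) Lc) Lc κ x (l, z) * 𝓘 (fun k => lev (k + 1)) n H B l z)) :
    ∀ (n : ℕ) (lev : ℕ → ℕ) (M : Fin (d + 1) → ℕ) (H B : Form1 (d + 1) ℝ),
      (∀ (l : Fin (d + 1)) (w t : Site (d + 1)), H l (translate (towerTorus Lc M n) w t) = H l w) →
      (∀ (l : Fin (d + 1)) (w t : Site (d + 1)), B l (translate (towerTorus Lc M n) w t) = B l w) →
      ∀ (l : Fin (d + 1)) (y t : Site (d + 1)), 𝓘 lev n H B l (translate M y t) = 𝓘 lev n H B l y := by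
  intro n
  induction n with
  | zero => intro lev M H B _ _ l y t; rw [h0]; rfl
  | succ n IH =>
      intro lev M H B hH hB l y t
      change ∀ (l : Fin (d + 1)) (w t : Site (d + 1)), H l (translate (towerTorus Lc (fine Lc M) n) w t) = H l w at hH
      change ∀ (l : Fin (d + 1)) (w t : Site (d + 1)), B l (translate (towerTorus Lc (fine Lc M) n) w t) = B l w at hB
      have IH' := IH (fun k => lev (k + 1)) (fine Lc M) H B hH hB
      have hBl := rows_periodic_of_clauses Lc 𝓡 hR0 hRsucc n (fun k => lev (k + 1)) (fine Lc M) B hB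
      have hHl := rows_periodic_of_clauses Lc 𝓡 hR0 hRsucc n (fun k => lev (k + 1)) (fine Lc M) H hH
      have htop := symVhKerAt_form_translate Lc M (ctr (d + 1) Lc) (𝓡 (fun k => lev (k + 1)) n H) (𝓡 (fun k => lev (k + 1)) n B) hHl hBl l y t
      have hlow := symLinKerAt_form_translate Lc M (ctr (d + 1) Lc) _ IH' l y t
      rw [hsucc, hsucc, hlow]
      exact congrArg (fun s : ℝ => (((Lc : ℝ) ^ (d + 1) * stepScale d Lc (lev 1)) * (∏ i ∈ Finset.range n, (stepScale d Lc (lev (i + 1 + 1)) * ((box (d + 1) Lc).card : ℝ)))⁻¹) * s + _) htop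

/-! ## §4 The entries of `compIns₁Sym … n h`: the functional at (the lift of `h`, the periodic indicator of a torus bond) -/

/-- [folklore] **THE ENTRIES OF THE SYM COMPOSITE FIRST-ORDER INSERTION JET**: for any `𝓡 ∕ 𝓘` with the clauses `hR0 ∕ hRsucc ∕ h0 ∕ hsucc` (letters from §3),
`compIns₁Sym Lc M lev rs n h (x, κ) (z, β) = 𝓘 lev n (lift h) ((l, w) ↦ δ_{(β,z)} (l, wrap T w)) κ x`, `T = towerTorus Lc M n` (§3 at the periodic indicator of the torus
bond `(z, β)`) — the matrix-level reading a kernel-side naming consumes. -/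
theorem compIns₁Sym_apply_eq (hc : ctrOff (d + 1) Lc ∈ box (d + 1) Lc)
    (𝓡 : (ℕ → ℕ) → ℕ → Form1 (d + 1) ℝ → Form1 (d + 1) ℝ)
    (hR0 : ∀ (lev : ℕ → ℕ) (B : Form1 (d + 1) ℝ), 𝓡 lev 0 B = B)
    (hRsucc : ∀ (lev : ℕ → ℕ) (n : ℕ) (B : Form1 (d + 1) ℝ) (κ : Fin (d + 1)) (x : Site (d + 1)),
      𝓡 lev (n + 1) B κ x = stepScale d Lc (lev 1) * ((Lc : ℝ) ^ (d + 1)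
        * ∑' z : Site (d + 1), ∑ l : Fin (d + 1), symLinKerAt (ctr (d + 1) Lc) Lc κ x (l, z) * 𝓡 (fun k => lev (k + 1)) n B l z))
    (𝓘 : (ℕ → ℕ) → ℕ → Form1 (d + 1) ℝ → Form1 (d + 1) ℝ → Form1 (d + 1) ℝ)
    (h0 : ∀ (lev : ℕ → ℕ) (H B : Form1 (d + 1) ℝ), 𝓘 lev 0 H B = 0)
    (hsucc : ∀ (lev : ℕ → ℕ) (n : ℕ) (H B : Form1 (d + 1) ℝ) (κ : Fin (d + 1)) (x : Site (d + 1)),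
      𝓘 lev (n + 1) H B κ x
        = (((Lc : ℝ) ^ (d + 1) * stepScale d Lc (lev 1)) * (∏ i ∈ Finset.range n, (stepScale d Lc (lev (i + 1 + 1)) * ((box (d + 1) Lc).card : ℝ)))⁻¹) *
            (∑' u : Site (d + 1), ∑ κ' : Fin (d + 1),
              (∑' z : Site (d + 1), ∑ l : Fin (d + 1), symVhKerAt (ctr (d + 1) Lc) Lc κ x (l, z) (κ', u) * 𝓡 (fun k => lev (k + 1)) n B l z) *
                𝓡 (fun k => lev (k + 1)) n H κ' u)
          + stepScale d Lc (lev 1) * ((Lc : ℝ) ^ (d + 1) *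
              ∑' z : Site (d + 1), ∑ l : Fin (d + 1), symLinKerAt (ctr (d + 1) Lc) Lc κ x (l, z) * 𝓘 (fun k => lev (k + 1)) n H B l z))
    (n : ℕ) (M : Fin (d + 1) → ℕ) [∀ μ, NeZero (M μ)] (lev : ℕ → ℕ) (rs : ℕ → (Fin (d + 1) → ℕ))
    (h : ↥(pbox (towerTorus Lc M n)) × Fin (d + 1) → ℝ) (x : ↥(pbox M)) (κ : Fin (d + 1)) (z : ↥(pbox (towerTorus Lc M n))) (β : Fin (d + 1)) :
    compIns₁Sym Lc M lev rs n h (x, κ) (z, β)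
      = 𝓘 lev n (fun l w => h (wrapPt (towerTorus Lc M n) w, l))
          (fun l w => KKTFluctuationKernel.delta1 β (z : Site (d + 1)) l (wrap (towerTorus Lc M n) w)) κ (x : Site (d + 1)) := by
  classical
  have hA : ∀ (l : Fin (d + 1)) (w t : Site (d + 1)),
      (fun l w => KKTFluctuationKernel.delta1 β (z : Site (d + 1)) l (wrap (towerTorus Lc M n) w)) l (translate (towerTorus Lc M n) w t)
        = (fun l w => KKTFluctuationKernel.delta1 β (z : Site (d + 1)) l (wrap (towerTorus Lc M n) w)) l w := fun l w t => by
    show KKTFluctuationKernel.delta1 β _ l (wrap _ (translate _ w t)) = KKTFluctuationKernel.delta1 β _ l (wrap _ w)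
    rw [wrap_congr (x' := w)]
    intro i
    rw [translate_apply]
    exact ⟨t i, by ring⟩
  rw [← sum_compIns₁Sym_mul_periodic Lc hc 𝓡 hR0 hRsucc (fun lev n T B => rows_periodic_of_clauses Lc 𝓡 hR0 hRsucc n lev T B) 𝓘 h0 hsucc
    (fun lev n M H B => periodic_of_clauses Lc 𝓡 hR0 hRsucc 𝓘 h0 hsucc n lev M H B) n M lev rs h _ hA x κ]
  have hval : ∀ q : ↥(pbox (towerTorus Lc M n)) × Fin (d + 1),
      (fun l w => KKTFluctuationKernel.delta1 β (z : Site (d + 1)) l (wrap (towerTorus Lc M n) w)) q.2 (q.1 : Site (d + 1))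
        = if q = (z, β) then 1 else 0 := fun q => by
    show KKTFluctuationKernel.delta1 β _ q.2 (wrap _ _) = _
    rw [B6Lemma24Torus.wrap_eq_self q.1.2, KKTFluctuationKernel.delta1_apply]
    obtain ⟨w, l⟩ := q
    by_cases hq : (w, l) = (z, β)
    · rw [if_pos hq, if_pos]
      obtain ⟨h1, h2⟩ := Prod.mk.inj hq
      exact ⟨h2, by rw [h1]⟩
    · rw [if_neg hq, if_neg]
      rintro ⟨h2, h1⟩
      exact hq (Prod.ext (Subtype.ext h1) h2)
  simp only [hval, mul_ite, mul_one, mul_zero, Finset.sum_ite_eq', Finset.mem_univ, if_true]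

end Summit.QuantumFields.BalabanUV.Beta.FP.TorusCompositeInsertionPeriodicSym

end
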